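import Mathlib
import Summits.ValiantsHypothesis.ValiantsHypothesis.Theorems.NewtonTauWeak.Negative.Zonogon
import Summits.ValiantsHypothesis.ValiantsHypothesis.Theorems.NewtonUnitEquationsNewtonTauWeakResidueDesignT2

/-!
# `NewtonUnitEquationsNewtonTauWeakGradedDesignT2` — T2 for graded designs from a level-set hull bound

Registered stub `stub_gradedDesignT2OfHull` of line `binomial-normal-form` (crux `NewtonTauWeak`,
stmt-ValiantsHypothesis-5904, lead c6): ANY uniform bound `Bnd` on the hull vertices of the graded level sets
`X_v = {Σ_{j∈J} d_j : Σ_{j∈J} g_j = v} ⊆ ℕ²` (THEOREM W of the line) yields the binomial normal form inequality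
`T2` for GRADED DESIGNS.

Setting.  A dissociated exponent list `d j ∈ ℕ²` (`j : Fin N`; all subset sums distinct), nonzero coefficients
`ρ j`, a grading `g j ∈ ℕ`, and `K` units `u l` with weights `cf l`.  The *graded design* is the sum of `K`
products of `N` binomials `f = Σ_{l<K} cf_l Π_j (1 − u_l^{g_j} ρ_j X^{d_j})`.

Claim.  If every level set `X_v` has at most `Bnd` hull vertices, then `vert f ≤ (Σ_j g_j + 1) · Bnd`.

Proof.
* (`GradedDesignT2Aux.coeff_graded`)  Expanding each product (`ResidueDesignT2Aux.prod_one_sub_eq_sum`), the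
  coefficient of `f` at `e` is `Σ_l Σ_{T : Σ_T d = e} cf_l Π_{j∈T} (−u_l^{g_j} ρ_j)`.
* (`GradedDesignT2Aux.coeff_graded_subsetSum`)  At a subset sum `e = Σ_J d` only `T = J` contributes
  (dissociation), and `Π_{j∈J} u_l^{g_j} = u_l^{Σ_J g_j}`, so `coeff_{Σ_J d} f = Π_{j∈J} (−ρ_j) · F(Σ_J g_j)` with
  the one-variable exponential polynomial `F(s) = Σ_l cf_l u_l^s`.
* (`GradedDesignT2Aux.support_graded_eq_biUnion`)  Hence (`ρ_j ≠ 0`) `supp f` is EXACTLY the union of the level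
  sets `X_s` over `s ∈ S = {s ≤ Σ_j g_j : F(s) ≠ 0}`.
* (`GradedDesignT2Aux.extremePoints_convexHull_biUnion_subset`, `…ncard_extremePoints_convexHull_biUnion_le`)
  An extreme point of the hull of a finite union lies in one of the pieces and is then extreme in the hull of
  that piece; so `vert f ≤ Σ_{s∈S} #ext conv X_s ≤ |S| · Bnd ≤ (Σ_j g_j + 1) · Bnd`.

Everything is folklore (expansion of binomial products, extreme points of a union); no named facts, no
citations, no `def`s.
-/

-- Sub = Summit single-conjunct layout: the duplicated namespace component is mandated by the tree.
set_option linter.dupNamespace false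

noncomputable section

open scoped BigOperators
open MvPolynomial
open Summit.ValiantsHypothesis.ValiantsHypothesis.Theorems.NewtonTauWeak.Negative (vert)

namespace Summit.ValiantsHypothesis.ValiantsHypothesis.Theorems.NewtonUnitEquationsNewtonTauWeak

namespace GradedDesignT2Aux

/-- Coefficients of the graded design, raw form: expanding every product,
`coeff_e f = Σ_l Σ_{T : Σ_T d = e} cf_l Π_{j ∈ T} (−u_l^{g_j} ρ_j)`. [folklore] -/
theorem coeff_graded {N K : ℕ} (g : Fin N → ℕ) (u cf : Fin K → ℂ) (ρ : Fin N → ℂ)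
    (d : Fin N → (Fin 2 →₀ ℕ)) (e : Fin 2 →₀ ℕ) :
    coeff e (∑ l, C (cf l) * ∏ j, (1 - C (u l ^ g j * ρ j) * monomial (d j) 1)) =
      ∑ l, ∑ T : Finset (Fin N),
        if ∑ j ∈ T, d j = e then cf l * ∏ j ∈ T, -(u l ^ g j * ρ j) else 0 := by
  rw [coeff_sum]
  refine Finset.sum_congr rfl fun l _ => ?_
  rw [ResidueDesignT2Aux.prod_one_sub_eq_sum, Finset.mul_sum, coeff_sum]
  refine Finset.sum_congr rfl fun T _ => ?_
  rw [C_mul_monomial, coeff_monomial]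

/-- Regrouping of the coefficient of one expanded product along the grading:
`Π_{j ∈ J} (−x^{g_j} ρ_j) = Π_{j ∈ J} (−ρ_j) · x^{Σ_{j∈J} g_j}`. [folklore] -/
theorem prod_neg_pow_mul_eq {N : ℕ} (g : Fin N → ℕ) (x : ℂ) (ρ : Fin N → ℂ) (J : Finset (Fin N)) :
    ∏ j ∈ J, -(x ^ g j * ρ j) = (∏ j ∈ J, -ρ j) * x ^ (∑ j ∈ J, g j) := by
  have h : ∀ j, -(x ^ g j * ρ j) = (-ρ j) * x ^ g j := fun j => by ring
  simp_rw [h]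
  rw [Finset.prod_mul_distrib, Finset.prod_pow_eq_pow_sum]

/-- **Coefficient formula on a dissociated frame.**  At the subset sum `Σ_J d` only `T = J` contributes, and the
grading collects into one power: `coeff_{Σ_J d} f = Π_{j ∈ J} (−ρ_j) · Σ_l cf_l u_l^{Σ_J g_j}`. [folklore] -/
theorem coeff_graded_subsetSum {N K : ℕ} (g : Fin N → ℕ) (u cf : Fin K → ℂ) (ρ : Fin N → ℂ)
    (d : Fin N → (Fin 2 →₀ ℕ))
    (hdis : ∀ J J' : Finset (Fin N), ∑ j ∈ J, d j = ∑ j ∈ J', d j → J = J') (J : Finset (Fin N)) :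
    coeff (∑ j ∈ J, d j) (∑ l, C (cf l) * ∏ j, (1 - C (u l ^ g j * ρ j) * monomial (d j) 1)) =
      (∏ j ∈ J, -ρ j) * ∑ l, cf l * u l ^ (∑ j ∈ J, g j) := by
  rw [coeff_graded, Finset.mul_sum]
  refine Finset.sum_congr rfl fun l _ => ?_
  rw [Finset.sum_eq_single J (fun T _ hTJ => if_neg fun h => hTJ (hdis T J h))
    (fun h => absurd (Finset.mem_univ J) h), if_pos rfl, prod_neg_pow_mul_eq, mul_left_comm]

open scoped Classical in
/-- **Support of the graded design** = the union of the graded level sets `X_s = {Σ_J d : Σ_J g = s}` over the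
levels `s ≤ Σ_j g_j` at which the exponential polynomial `F(s) = Σ_l cf_l u_l^s` does not vanish: off the subset
sums every raw summand vanishes, and at `Σ_J d` the coefficient is `Π_{j∈J} (−ρ_j) ≠ 0` times `F(Σ_J g)`.
[folklore] -/
theorem support_graded_eq_biUnion {N K : ℕ} (g : Fin N → ℕ) (u cf : Fin K → ℂ) (ρ : Fin N → ℂ)
    (hρ : ∀ j, ρ j ≠ 0) (d : Fin N → (Fin 2 →₀ ℕ))
    (hdis : ∀ J J' : Finset (Fin N), ∑ j ∈ J, d j = ∑ j ∈ J', d j → J = J') :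
    ((∑ l, C (cf l) * ∏ j, (1 - C (u l ^ g j * ρ j) * monomial (d j) 1)).support : Set (Fin 2 →₀ ℕ)) =
      ⋃ s ∈ (Finset.range (∑ j, g j + 1)).filter (fun s => (∑ l, cf l * u l ^ s) ≠ 0),
        ((((Finset.univ.filter fun J : Finset (Fin N) => ∑ j ∈ J, g j = s).image
          fun J => ∑ j ∈ J, d j : Finset (Fin 2 →₀ ℕ)) : Set (Fin 2 →₀ ℕ))) := by
  have hprod : ∀ J : Finset (Fin N), ∏ j ∈ J, -ρ j ≠ 0 := fun J =>
    Finset.prod_ne_zero_iff.mpr fun j _ => neg_ne_zero.mpr (hρ j)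
  ext e
  simp only [Finset.mem_coe, mem_support_iff, Set.mem_iUnion, Finset.mem_filter, Finset.mem_range,
    Finset.mem_image, Finset.mem_univ, true_and, exists_prop]
  constructor
  · intro he
    by_cases hex : ∃ J : Finset (Fin N), ∑ j ∈ J, d j = e
    · obtain ⟨J, rfl⟩ := hex
      rw [coeff_graded_subsetSum g u cf ρ d hdis J] at he
      refine ⟨∑ j ∈ J, g j, ⟨?_, fun h0 => he (by rw [h0, mul_zero])⟩, J, rfl, rfl⟩
      exact Nat.lt_succ_of_le (Finset.sum_le_univ_sum_of_nonneg fun _ => Nat.zero_le _)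
    · refine absurd ?_ he
      rw [coeff_graded]
      exact Finset.sum_eq_zero fun l _ => Finset.sum_eq_zero fun T _ => if_neg fun hT => hex ⟨T, hT⟩
  · rintro ⟨s, ⟨-, hFs⟩, J, hJ, rfl⟩
    rw [coeff_graded_subsetSum g u cf ρ d hdis J, hJ]
    exact mul_ne_zero (hprod J) hFs

/-- Extreme points of the hull of a finite union lie among the extreme points of the hulls of the pieces: an
extreme point of `conv(⋃ A_i)` lies in `⋃ A_i` (`extremePoints_convexHull_subset`), hence in some
`A_i ⊆ conv A_i ⊆ conv(⋃ A_i)`, and an extreme point of the bigger convex set lying in the smaller one is extreme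
there. [folklore] -/
theorem extremePoints_convexHull_biUnion_subset {E ι : Type*} [AddCommGroup E] [Module ℝ E]
    (S : Finset ι) (A : ι → Set E) :
    (convexHull ℝ (⋃ i ∈ S, A i)).extremePoints ℝ ⊆ ⋃ i ∈ S, (convexHull ℝ (A i)).extremePoints ℝ := by
  intro x hx
  obtain ⟨i, hi, hxi⟩ := Set.mem_iUnion₂.mp (extremePoints_convexHull_subset hx)
  exact Set.mem_iUnion₂.mpr ⟨i, hi, inter_extremePoints_subset_extremePoints_of_subset
    (convexHull_mono (Set.subset_iUnion₂ (s := fun i (_ : i ∈ S) => A i) i hi))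
      ⟨subset_convexHull ℝ _ hxi, hx⟩⟩

/-- Counting form of `extremePoints_convexHull_biUnion_subset` for finitely many finite pieces:
`#ext conv(⋃_{i∈S} A_i) ≤ Σ_{i∈S} #ext conv(A_i)`. [folklore] -/
theorem ncard_extremePoints_convexHull_biUnion_le {E ι : Type*} [AddCommGroup E] [Module ℝ E]
    (S : Finset ι) (A : ι → Set E) (hA : ∀ i ∈ S, (A i).Finite) :
    ((convexHull ℝ (⋃ i ∈ S, A i)).extremePoints ℝ).ncard ≤
      ∑ i ∈ S, ((convexHull ℝ (A i)).extremePoints ℝ).ncard := by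
  have hfin : (⋃ i ∈ S, (convexHull ℝ (A i)).extremePoints ℝ).Finite :=
    S.finite_toSet.biUnion fun i hi => (hA i hi).subset extremePoints_convexHull_subset
  exact (Set.ncard_le_ncard (extremePoints_convexHull_biUnion_subset S A) hfin).trans
    (Finset.set_ncard_biUnion_le S _)

end GradedDesignT2Aux

/-- **T2 for graded designs from a level-set hull bound.**  On a dissociated exponent list `d` with nonzero
coefficients `ρ`, the graded design `f = Σ_{l<K} cf_l Π_j (1 − u_l^{g_j} ρ_j X^{d_j})` has coefficient
`Π_{j∈J} (−ρ_j) · F(Σ_J g_j)` at `Σ_J d_j` (`F(s) = Σ_l cf_l u_l^s`) and no other monomials, so `supp f` is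
EXACTLY the union of the graded level sets `X_s = {Σ_J d : Σ_J g = s}` over `s ∈ {s ≤ Σ_j g_j : F(s) ≠ 0}`; an
extreme point of the hull of a finite union is extreme in the hull of a piece, so any uniform bound `Bnd` on the
hull vertices of the level sets gives `vert f ≤ (Σ_j g_j + 1) · Bnd`. [folklore] -/
theorem stub_gradedDesignT2OfHull (N K Bnd : ℕ) (g : Fin N → ℕ)
    (u cf : Fin K → ℂ) (ρ : Fin N → ℂ) (hρ : ∀ j, ρ j ≠ 0) (d : Fin N → (Fin 2 →₀ ℕ))
    (hdis : ∀ J J' : Finset (Fin N), ∑ j ∈ J, d j = ∑ j ∈ J', d j → J = J')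
    (hX : ∀ v : ℕ, (Set.extremePoints ℝ (convexHull ℝ
      ((fun e : Fin 2 →₀ ℕ => fun i : Fin 2 => ((e i : ℕ) : ℝ)) ''
        (((Finset.univ.filter fun J : Finset (Fin N) => ∑ j ∈ J, g j = v).image
          fun J => ∑ j ∈ J, d j : Finset (Fin 2 →₀ ℕ)) : Set (Fin 2 →₀ ℕ))))).ncard ≤ Bnd) :
    vert (∑ l, C (cf l) * ∏ j, (1 - C (u l ^ g j * ρ j) * monomial (d j) 1)) ≤ (∑ j, g j + 1) * Bnd := by
  unfold vert
  rw [GradedDesignT2Aux.support_graded_eq_biUnion g u cf ρ hρ d hdis, Set.image_iUnion₂]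
  refine (GradedDesignT2Aux.ncard_extremePoints_convexHull_biUnion_le _ _ fun s _ =>
    (Finset.finite_toSet _).image _).trans ?_
  refine (Finset.sum_le_sum fun s _ => hX s).trans ?_
  rw [Finset.sum_const, smul_eq_mul]
  refine (Nat.mul_le_mul_right _ (Finset.card_filter_le _ _)).trans_eq ?_
  rw [Finset.card_range]

end Summit.ValiantsHypothesis.ValiantsHypothesis.Theorems.NewtonUnitEquationsNewtonTauWeak

end
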